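import Mathlib
import HarnessLib
import Literature.MathematicalPhysics.QuantumManyBody.BoseGasFreeDirichletBEC
import Summits.AtomisticToContinuum.BoseEinsteinCondensation.Theses.NumberPhaseSandwich

/-!
# Route NumberPhaseSandwich — support item `LossBookkeeping` (stmt-AtomisticToContinuum-32640), part 1/2: CELLS

Port (decomp-a2c census g7, prover seat) of lens-6 g10's kernel-proved off-tree file `LossBookkeepingProof.lean` (sha256 55ccb75b…, 0 sorry),
split at 400 lines: (A) the finite Parseval identity card s · ∑‖aᵢ‖² = ‖∑ aᵢ‖² + ½∑ᵢ∑ⱼ‖aᵢ − aⱼ‖² and its ℝ≥0∞ form for card s ≥ 8;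
the dyadic parent map `par`, `children`, `child`, 8 ≤ card (children P), sums over children; (B, first half) a parent cell of side 2ℓ is the
disjoint union of its children (`subCell_parent_eq`, `pairwiseDisjoint_children`). Part 2 (NumberPhaseSandwichLossBookkeeping) does the slices,
the dipole bound and `lossBookkeeping` BY NAME.
-/

noncomputable section

namespace Summit.AtomisticToContinuum.BoseEinsteinCondensation.Theorems.NumberPhaseSandwichLossBookkeepingCells

open Literature.MathematicalPhysics.QuantumManyBody.BoseGas Finset MeasureTheory
open scoped NNReal ENNReal

/-- `card s · ∑‖aᵢ‖² = ‖∑ aᵢ‖² + ½ ∑ᵢ∑ⱼ ‖aᵢ - aⱼ‖²` for complex numbers. -/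
theorem parseval_real {ι : Type*} (s : Finset ι) (a : ι → ℂ) :
    (s.card : ℝ) * ∑ i ∈ s, ‖a i‖ ^ 2 =
      ‖∑ i ∈ s, a i‖ ^ 2 + 2⁻¹ * ∑ i ∈ s, ∑ j ∈ s, ‖a i - a j‖ ^ 2 := by
  set S := ∑ i ∈ s, ‖a i‖ ^ 2 with hS
  have h1 : ‖∑ i ∈ s, a i‖ ^ 2 = ∑ i ∈ s, ∑ j ∈ s, @inner ℝ ℂ _ (a i) (a j) := by
    rw [← real_inner_self_eq_norm_sq, sum_inner]
    refine Finset.sum_congr rfl fun i _ => ?_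
    rw [inner_sum]
  have h2 : ∀ i j, ‖a i - a j‖ ^ 2 = ‖a i‖ ^ 2 - 2 * @inner ℝ ℂ _ (a i) (a j) + ‖a j‖ ^ 2 :=
    fun i j => norm_sub_sq_real (a i) (a j)
  have hsum : ∑ i ∈ s, ∑ j ∈ s, ‖a i - a j‖ ^ 2 =
      (s.card : ℝ) * S - 2 * ∑ i ∈ s, ∑ j ∈ s, @inner ℝ ℂ _ (a i) (a j) + (s.card : ℝ) * S := by
    have h3 : ∀ i ∈ s, ∑ j ∈ s, ‖a i - a j‖ ^ 2 =
        (s.card : ℝ) * ‖a i‖ ^ 2 - 2 * ∑ j ∈ s, @inner ℝ ℂ _ (a i) (a j) + S := by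
      intro i _
      simp_rw [h2]
      rw [Finset.sum_add_distrib, Finset.sum_sub_distrib, Finset.sum_const, nsmul_eq_mul,
        Finset.mul_sum]
    rw [Finset.sum_congr rfl h3, Finset.sum_add_distrib, Finset.sum_sub_distrib, ← Finset.mul_sum,
      ← Finset.mul_sum, Finset.sum_const, nsmul_eq_mul]
  rw [h1, hsum]
  ring

/-- The inequality form used below: if `8 ≤ card s` then
`∑‖aᵢ‖² ≤ 8⁻¹ ‖∑ aᵢ‖² + 16⁻¹ ∑ᵢ∑ⱼ ‖aᵢ - aⱼ‖²` (in `ℝ≥0`, squared `nnnorm`s). -/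
theorem parseval_nnreal_le {ι : Type*} (s : Finset ι) (hs : 8 ≤ s.card) (a : ι → ℂ) :
    (∑ i ∈ s, ‖a i‖₊ ^ 2 : ℝ≥0) ≤
      8⁻¹ * ‖∑ i ∈ s, a i‖₊ ^ 2 + 16⁻¹ * ∑ i ∈ s, ∑ j ∈ s, ‖a i - a j‖₊ ^ 2 := by
  rw [← NNReal.coe_le_coe]
  push_cast
  have h := parseval_real s a
  have hc : (8 : ℝ) ≤ s.card := by exact_mod_cast hs
  have hS : 0 ≤ ∑ i ∈ s, ‖a i‖ ^ 2 := Finset.sum_nonneg fun i _ => by positivity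
  have hD : 0 ≤ ∑ i ∈ s, ∑ j ∈ s, ‖a i - a j‖ ^ 2 :=
    Finset.sum_nonneg fun i _ => Finset.sum_nonneg fun j _ => by positivity
  nlinarith [norm_nonneg (∑ i ∈ s, a i)]

/-- The same in `ℝ≥0∞`. -/
theorem parseval_ennreal_le {ι : Type*} (s : Finset ι) (hs : 8 ≤ s.card) (a : ι → ℂ) :
    (∑ i ∈ s, ((‖a i‖₊ : ℝ≥0∞) ^ 2) : ℝ≥0∞) ≤
      8⁻¹ * (‖∑ i ∈ s, a i‖₊ : ℝ≥0∞) ^ 2 +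
        16⁻¹ * ∑ i ∈ s, ∑ j ∈ s, (‖a i - a j‖₊ : ℝ≥0∞) ^ 2 := by
  have h := ENNReal.coe_le_coe.2 (parseval_nnreal_le s hs a)
  push_cast [ENNReal.ofNNReal_finsetSum] at h
  rw [ENNReal.coe_inv (by norm_num), ENNReal.coe_inv (by norm_num)] at h
  simpa using h

/-! ## The dyadic parent map on sub-cell indices -/

/-- Helper `two_pow_le_two_mul` (ported verbatim from the lens-6 g10 kernel file). -/
theorem two_pow_le_two_mul (k : ℕ) : 2 ^ k ≤ 2 * 2 ^ (k - 1) := by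
  rcases k with _ | k
  · norm_num
  · simp [pow_succ, mul_comm]

/-- parent index `⌊c/2⌋` (total: for `k = 0` it is the trivial map). -/
def par {k : ℕ} (c : SubIdx (2 ^ k)) : SubIdx (2 ^ (k - 1)) := fun j =>
  ⟨(c j : ℕ) / 2, Nat.div_lt_of_lt_mul (lt_of_lt_of_le (c j).isLt (by
    simpa [mul_comm] using two_pow_le_two_mul k))⟩

/-- Helper `par_apply` (ported verbatim from the lens-6 g10 kernel file). -/
@[simp] theorem par_apply {k : ℕ} (c : SubIdx (2 ^ k)) (j : Fin 3) : ((par c j : ℕ)) = (c j : ℕ) / 2 := rfl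

/-- Helper `sib_iff` (ported verbatim from the lens-6 g10 kernel file). -/
theorem sib_iff {k : ℕ} (c c' : SubIdx (2 ^ k)) :
    (∀ j : Fin 3, (c j : ℕ) / 2 = (c' j : ℕ) / 2) ↔ par c = par c' := by
  constructor
  · intro h; funext j; exact Fin.ext (h j)
  · intro h j; have := congrArg (fun f => ((f j : ℕ))) h; simpa using this

/-- the children of `P`. -/
def children {k : ℕ} (P : SubIdx (2 ^ (k - 1))) : Finset (SubIdx (2 ^ k)) :=
  Finset.univ.filter fun c => par c = P

/-- Helper `mem_children` (ported verbatim from the lens-6 g10 kernel file). -/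
theorem mem_children {k : ℕ} {P : SubIdx (2 ^ (k - 1))} {c : SubIdx (2 ^ k)} :
    c ∈ children P ↔ par c = P := by simp [children]

/-- the explicit child `2P + e`, `e ∈ {0,1}³` (needs `1 ≤ k`). -/
def child {k : ℕ} (hk : 1 ≤ k) (P : SubIdx (2 ^ (k - 1))) (e : Fin 3 → Fin 2) : SubIdx (2 ^ k) :=
  fun j => ⟨2 * (P j : ℕ) + (e j : ℕ), by
    have hP := (P j).isLt
    have he := (e j).isLt
    have : 2 ^ k = 2 * 2 ^ (k - 1) := by
      obtain ⟨k', rfl⟩ := Nat.exists_eq_add_of_le' hk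
      simp [pow_succ, mul_comm]
    omega⟩

/-- Helper `par_child` (ported verbatim from the lens-6 g10 kernel file). -/
theorem par_child {k : ℕ} (hk : 1 ≤ k) (P : SubIdx (2 ^ (k - 1))) (e : Fin 3 → Fin 2) :
    par (child hk P e) = P := by
  funext j
  apply Fin.ext
  simp only [par_apply, child]
  have he := (e j).isLt
  omega

/-- Helper `child_injective` (ported verbatim from the lens-6 g10 kernel file). -/
theorem child_injective {k : ℕ} (hk : 1 ≤ k) (P : SubIdx (2 ^ (k - 1))) :
    Function.Injective (child hk P) := by
  intro e e' h
  funext j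
  have := congrArg (fun f => ((f j : ℕ))) h
  simp only [child] at this
  exact Fin.ext (by omega)

/-- Helper `eight_le_card_children` (ported verbatim from the lens-6 g10 kernel file). -/
theorem eight_le_card_children {k : ℕ} (hk : 1 ≤ k) (P : SubIdx (2 ^ (k - 1))) :
    8 ≤ (children P).card := by
  have h1 : (Finset.univ.image (child hk P)).card = 8 := by
    rw [Finset.card_image_of_injective _ (child_injective hk P)]
    simp
  rw [← h1]
  refine Finset.card_le_card fun c hc => ?_
  obtain ⟨e, _, rfl⟩ := Finset.mem_image.1 hc
  exact mem_children.2 (par_child hk P e)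

/-- fiberwise re-indexing of a sum over level-`k` cells by parents. -/
theorem sum_eq_sum_children {k : ℕ} {M : Type*} [AddCommMonoid M] (F : SubIdx (2 ^ k) → M) :
    ∑ c : SubIdx (2 ^ k), F c = ∑ P : SubIdx (2 ^ (k - 1)), ∑ c ∈ children P, F c := by
  rw [← Finset.sum_fiberwise_of_maps_to (s := Finset.univ) (t := Finset.univ) (g := par)
    (fun c _ => Finset.mem_univ _) F]
  rfl


/-! ## Geometry: a parent cell of side `2ℓ` is the disjoint union of its 8 children of side `ℓ` -/

/-- Helper `nat_div_two_bounds` (ported verbatim from the lens-6 g10 kernel file). -/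
theorem nat_div_two_bounds (m : ℕ) : 2 * (m / 2) ≤ m ∧ m < 2 * (m / 2) + 2 := by omega

/-- Helper `subCell_parent_eq` (ported verbatim from the lens-6 g10 kernel file). -/
theorem subCell_parent_eq {k : ℕ} (hk : 1 ≤ k) {ℓ : ℝ} (hℓ : 0 < ℓ) (P : SubIdx (2 ^ (k - 1))) :
    subCell (2 * ℓ) P = ⋃ c ∈ children P, subCell ℓ c := by
  ext x
  simp only [Set.mem_iUnion, exists_prop]
  constructor
  · intro hx
    rw [mem_subCell] at hx
    -- choose the octant
    let e : Fin 3 → Fin 2 := fun i => if x i < 2 * ℓ * ((P i : ℕ) : ℝ) + ℓ then 0 else 1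
    refine ⟨child hk P e, mem_children.2 (par_child hk P e), ?_⟩
    rw [mem_subCell]
    intro i
    obtain ⟨h1, h2⟩ := hx i
    have hc : (((child hk P e) i : ℕ) : ℝ) = 2 * ((P i : ℕ) : ℝ) + ((e i : ℕ) : ℝ) := by
      simp only [child]; push_cast; ring
    rw [hc]
    by_cases hlt : x i < 2 * ℓ * ((P i : ℕ) : ℝ) + ℓ
    · have he : ((e i : ℕ) : ℝ) = 0 := by simp [e, hlt]
      rw [he]; constructor <;> nlinarith
    · have he : ((e i : ℕ) : ℝ) = 1 := by simp [e, hlt]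
      rw [he]; push Not at hlt; constructor <;> nlinarith
  · rintro ⟨c, hc, hx⟩
    rw [mem_children] at hc
    rw [mem_subCell] at hx ⊢
    intro i
    obtain ⟨h1, h2⟩ := hx i
    have hci : (c i : ℕ) / 2 = (P i : ℕ) := by
      have := congrArg (fun f => ((f i : ℕ))) hc; simpa using this
    obtain ⟨hlo, hhi⟩ := nat_div_two_bounds (c i : ℕ)
    rw [hci] at hlo hhi
    have hlo' : 2 * ((P i : ℕ) : ℝ) ≤ ((c i : ℕ) : ℝ) := by exact_mod_cast hlo
    have hhi' : ((c i : ℕ) : ℝ) + 1 ≤ 2 * ((P i : ℕ) : ℝ) + 2 := by exact_mod_cast hhi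
    constructor <;> nlinarith

/-- Helper `pairwiseDisjoint_children` (ported verbatim from the lens-6 g10 kernel file). -/
theorem pairwiseDisjoint_children {k : ℕ} {ℓ : ℝ} (hℓ : 0 < ℓ) (P : SubIdx (2 ^ (k - 1))) :
    Set.Pairwise (↑(children P) : Set (SubIdx (2 ^ k))) (Function.onFun Disjoint (subCell ℓ)) := by
  intro c _ c' _ hne
  exact Set.disjoint_left.2 fun x hx hx' => not_mem_subCell_of_ne hℓ hne hx hx'


end Summit.AtomisticToContinuum.BoseEinsteinCondensation.Theorems.NumberPhaseSandwichLossBookkeepingCells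

end
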